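import Literature.NumberTheory.Automorphic.BrandtModuleProofs
import Literature.NumberTheory.Automorphic.BrandtModuleMultiplicativity
import HarnessLib

/-!
# Intermediate lattices of coprime indices are invertible; `T(mn) = T(m) T(n)` and
# `T(m) T(n) = T(n) T(m)` for coprime `m, n`, unconditionally, in the vocabulary of `BrandtXi.lean`

Topic `NumberTheory/Automorphic`; theorems only (no definition, no named fact, no instance).
`BrandtMultiplicativity.lean` proved Eichler's unique-factorisation identity
`T(mn) = T(m) T(n)` (`gcd(m, n) = 1`) for the Brandt matrices `Brandt.matrix O n` of
`BrandtXi.lean` (the matrices entering Pollack–Weston's `ξ_f(N⁺, N⁻)`, `brandtXi`) under one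
arithmetic hypothesis: *a lattice `K` with `M ⊆ K ⊆ I`, `M, I` invertible right `O`-ideals and
`gcd([K : M], [I : K]) = 1`, is again an invertible right `O`-ideal*. Meanwhile
`BrandtModuleProofs.lean` (discharging the named fact `brandtMatrix_mul_of_coprime` of
`BrandtModule.lean`) proved the global form of exactly this input for square indices:
`IsInvertibleRightIdeal.sup_smul` — `M + c I` is invertible whenever `a c + b d = 1` and
`c d I ⊆ M`. Here we derive the hypothesis in full generality and remove it:

* `IsInvertibleRightIdeal.of_coprime_intermediate` — with `c = [I : K]`, `d = [K : M]` coprime,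
  `K = M + c I` (Bézout: `x = a (c x) + b (d x)` with `c x ∈ c I`, `d x ∈ M`), and
  `c d I = [I : M] I ⊆ M`, so `IsInvertibleRightIdeal.sup_smul` applies;
* `Brandt.mem_rightIdeals_of_coprime_intermediate` — the same in the vocabulary
  `Brandt.rightIdeals` for orders of a totally definite quaternion algebra over `ℚ`;
* `Brandt.matrix_mul_of_coprime`, `Brandt.matrix_comm_of_coprime` — **`T(mn) = T(m) T(n)`
  and `T(m) T(n) = T(n) T(m)` for coprime `m, n`**, for every `ℤ`-order of a totally definite
  quaternion algebra over `ℚ` (Vignéras III §5 ex. 5.8 (c)–(d); Eichler 1973 II §6 Thm. 2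
  (18)); `Brandt.XiSetup.matrix_mul_of_coprime`, `Brandt.XiSetup.matrix_comm_of_coprime` for
  Brandt setups; and, for Eichler packages, `EichlerPackage.T_comm_of_coprime` (from the
  discharged `brandtMatrix_mul_of_coprime_holds`).

## References

* M.-F. Vignéras, *Arithmétique des algèbres de quaternions*, LNM 800 (1980), Ch. III §5
  exercice 5.8 (c)–(d) [VignerasLNM800].
* M. Eichler, LNM 320 (1973), Ch. II §6 Thm. 2 (18), (23) [Eichler1973].
-/

noncomputable section

open scoped Pointwise

universe u

namespace Literature.NumberTheory.Automorphic

/-! ### Intermediate lattices of coprime indices -/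

section Intermediate

variable {B : Type u} [Ring B]

/-- **An intermediate lattice of coprime indices is `M + [I : K] I`.** If `M ⊆ K ⊆ I` with
`gcd([K : M], [I : K]) = 1` then `K = M + [I : K] • I` (Bézout). [folklore] -/
theorem eq_sup_relIndex_smul_of_coprime {M K I : Submodule ℤ B} (hMK : M ≤ K) (hKI : K ≤ I)
    (hcop : Nat.Coprime (M.toAddSubgroup.relIndex K.toAddSubgroup)
      (K.toAddSubgroup.relIndex I.toAddSubgroup)) :
    K = M ⊔ ((K.toAddSubgroup.relIndex I.toAddSubgroup : ℕ) : ℤ) • I := by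
  set c : ℕ := K.toAddSubgroup.relIndex I.toAddSubgroup with hc
  set d : ℕ := M.toAddSubgroup.relIndex K.toAddSubgroup with hd
  refine le_antisymm (fun x hx => ?_) (sup_le hMK fun z hz => ?_)
  · obtain ⟨a, b, hab⟩ := Nat.isCoprime_iff_coprime.mpr hcop
    -- `x = b (c x) + a (d x)` with `c x ∈ c I` and `d x ∈ M`
    have hx' : x = b • ((c : ℤ) • x) + a • ((d : ℤ) • x) := by
      rw [smul_smul, smul_smul, ← add_smul, mul_comm b, mul_comm a, add_comm,
        mul_comm (d : ℤ), mul_comm (c : ℤ), hab, one_smul]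
    rw [hx']
    refine add_mem (Submodule.smul_mem _ _ (Submodule.mem_sup_right
      (Submodule.smul_mem_pointwise_smul x _ I (hKI hx)))) (Submodule.smul_mem _ _
        (Submodule.mem_sup_left ?_))
    exact zsmul_relIndex_mem hx
  · obtain ⟨x, hx, rfl⟩ := (Submodule.mem_smul_pointwise_iff_exists z _ I).mp hz
    exact zsmul_relIndex_mem hx

/-- **Intermediate lattices of coprime indices between invertible right ideals are invertible
right ideals** (the local input of Eichler's unique factorisation, LNM 320 II §6 (23), in global
form): for invertible right `O`-ideals `M ⊆ I` and a lattice `M ⊆ K ⊆ I` with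
`gcd([K : M], [I : K]) = 1`, `K` is an invertible right `O`-ideal — it is `M + c I`,
`c = [I : K]`, and `IsInvertibleRightIdeal.sup_smul` applies with `c d I = [I : M] I ⊆ M`. [cite: Eichler1973, Ch. II §6 Thm. 2, (23)] -/
theorem IsInvertibleRightIdeal.of_coprime_intermediate {O M K I : Submodule ℤ B}
    (hM : IsInvertibleRightIdeal O M) (hI : IsInvertibleRightIdeal O I) (hMK : M ≤ K)
    (hKI : K ≤ I) (hcop : Nat.Coprime (M.toAddSubgroup.relIndex K.toAddSubgroup)
      (K.toAddSubgroup.relIndex I.toAddSubgroup)) :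
    IsInvertibleRightIdeal O K := by
  obtain ⟨a, b, hab⟩ := Nat.isCoprime_iff_coprime.mpr hcop.symm
  rw [eq_sup_relIndex_smul_of_coprime hMK hKI hcop]
  refine hM.sup_smul hI (hMK.trans hKI) hab fun z hz => ?_
  obtain ⟨x, hx, rfl⟩ := (Submodule.mem_smul_pointwise_iff_exists z _ I).mp hz
  have hmul := AddSubgroup.relIndex_mul_relIndex M.toAddSubgroup K.toAddSubgroup I.toAddSubgroup
    (fun y hy => hMK hy) (fun y hy => hKI hy)
  have : ((K.toAddSubgroup.relIndex I.toAddSubgroup : ℕ) : ℤ) *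
      ((M.toAddSubgroup.relIndex K.toAddSubgroup : ℕ) : ℤ) =
        ((M.toAddSubgroup.relIndex I.toAddSubgroup : ℕ) : ℤ) := by
    rw [← hmul]; push_cast; ring
  rw [this]
  exact zsmul_relIndex_mem hx

end Intermediate

/-! ### Totally definite quaternion algebras over `ℚ`: the vocabulary of `BrandtXi.lean` -/

namespace Brandt

variable {D : Type u} [Ring D] [Algebra ℚ D] [IsQuaternionAlgebra ℚ D]

/-- **Intermediate lattices of coprime indices are in `Brandt.rightIdeals O`**, for a `ℤ`-order
`O` of a totally definite quaternion algebra over `ℚ` (where `Brandt.rightIdeals O` is the set of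
invertible right `O`-ideals, `rightIdeals_eq_invertibleRightIdeals_of_isTotallyDefinite`). [cite: Eichler1973, Ch. II §6 Thm. 2, (23)] -/
theorem mem_rightIdeals_of_coprime_intermediate (hdef : IsTotallyDefinite ℚ D)
    {O : Submodule ℤ D} (hO : IsOrder D O) {M : Submodule ℤ D} (hM : M ∈ rightIdeals O)
    {I : Submodule ℤ D} (hI : I ∈ rightIdeals O) {K : Submodule ℤ D} (hMK : M ≤ K) (hKI : K ≤ I)
    (hcop : Nat.Coprime (M.toAddSubgroup.relIndex K.toAddSubgroup)
      (K.toAddSubgroup.relIndex I.toAddSubgroup)) :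
    K ∈ rightIdeals O := by
  have hZ : IsZOrder O := isZOrder_iff_isOrder.mpr hO
  rw [rightIdeals_eq_invertibleRightIdeals_of_isTotallyDefinite hdef hZ] at hM hI ⊢
  exact IsInvertibleRightIdeal.of_coprime_intermediate hM hI hMK hKI hcop

/-- **`T(mn) = T(m) T(n)` for coprime `m, n`** for the Brandt matrices `Brandt.matrix O` of a
`ℤ`-order `O` in a totally definite quaternion algebra over `ℚ` (Vignéras III §5 ex. 5.8 (c);
Eichler 1973 II §6 Thm. 2 (18)): `Brandt.matrix_mul_of_coprime_of_forall_mem_rightIdeals` with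
both its hypotheses discharged (`units_smul_mem_rightIdeals_of_isTotallyDefinite`,
`mem_rightIdeals_of_coprime_intermediate`). [cite: VignerasLNM800, Ch. III §5 exercice 5.8 (c)] -/
theorem matrix_mul_of_coprime (hdef : IsTotallyDefinite ℚ D) {O : Submodule ℤ D}
    (hO : IsOrder D O) [Fintype (ClassSet O)] {m n : ℕ} (hmn : Nat.Coprime m n) :
    matrix O (m * n) = matrix O m * matrix O n := by
  classical
  haveI : IsAddTorsionFree D := isAddTorsionFree_of_charZero_module ℚ D
  exact matrix_mul_of_coprime_of_forall_mem_rightIdeals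
    (fun _ hI β => units_smul_mem_rightIdeals_of_isTotallyDefinite hdef hO hI β)
    (fun _ hM _ hI _ hMK hKI hcop => mem_rightIdeals_of_coprime_intermediate hdef hO hM hI hMK
      hKI hcop) hmn

/-- **`T(m) T(n) = T(n) T(m)` for coprime `m, n`** (both products are `T(mn)`; Vignéras III §5
ex. 5.8 (d)). [cite: VignerasLNM800, Ch. III §5 exercice 5.8 (c)–(d)] -/
theorem matrix_comm_of_coprime (hdef : IsTotallyDefinite ℚ D) {O : Submodule ℤ D}
    (hO : IsOrder D O) [Fintype (ClassSet O)] {m n : ℕ} (hmn : Nat.Coprime m n) :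
    matrix O m * matrix O n = matrix O n * matrix O m := by
  rw [← matrix_mul_of_coprime hdef hO hmn, ← matrix_mul_of_coprime hdef hO hmn.symm, mul_comm]

variable {Nplus Nminus : ℕ}

/-- **`T(mn) = T(m) T(n)` for coprime `m, n`, for every Brandt setup of type `(N⁺, N⁻)`**
(the Hecke matrices behind `Brandt.XiSetup.xi` / `brandtXi`). [cite: VignerasLNM800, Ch. III §5 exercice 5.8 (c)] -/
theorem XiSetup.matrix_mul_of_coprime (S : XiSetup Nplus Nminus) [Fintype (ClassSet S.O)]
    {m n : ℕ} (hmn : Nat.Coprime m n) : matrix S.O (m * n) = matrix S.O m * matrix S.O n :=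
  Brandt.matrix_mul_of_coprime S.isTotallyDefinite S.isEichlerOrder.isOrder hmn

/-- **`T(m) T(n) = T(n) T(m)` for coprime `m, n`, for every Brandt setup.** [cite: VignerasLNM800, Ch. III §5 exercice 5.8 (c)–(d)] -/
theorem XiSetup.matrix_comm_of_coprime (S : XiSetup Nplus Nminus) [Fintype (ClassSet S.O)]
    {m n : ℕ} (hmn : Nat.Coprime m n) : matrix S.O m * matrix S.O n = matrix S.O n * matrix S.O m :=
  Brandt.matrix_comm_of_coprime S.isTotallyDefinite S.isEichlerOrder.isOrder hmn

end Brandt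

/-- **`B(m) B(n) = B(n) B(m)` for coprime `m, n`**, for the Brandt data of every Eichler package
(both sides are `B(mn)`, by the discharged named fact `brandtMatrix_mul_of_coprime_holds`). [cite: VignerasLNM800, Ch. III §5 exercice 5.8 (c)–(d)] -/
theorem EichlerPackage.T_comm_of_coprime {Nplus Nminus : ℕ} (P : EichlerPackage Nplus Nminus)
    {m n : ℕ} (hmn : Nat.Coprime m n) :
    P.brandtData.T m * P.brandtData.T n = P.brandtData.T n * P.brandtData.T m := by
  rw [← brandtMatrix_mul_of_coprime_holds Nplus Nminus P m n hmn,
    ← brandtMatrix_mul_of_coprime_holds Nplus Nminus P n m hmn.symm, mul_comm]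

end Literature.NumberTheory.Automorphic

end
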